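import Summits.KontsevichZagierPeriods.KontsevichZagierPeriods.Theorems.SoloInformedToricProducts
import HarnessLib

/-!
# The cube crux for the cubical multiple-zeta integrals

Solo programme `solo-KontsevichZagierPeriods-informed`, session s104.

**Extension lemma.**  Cube-nondegeneracy is stable under injective renaming of variables
(`soloInformed_cubeNondegenerate_rename`): `in_w(Q ∘ f) = (in_{w∘f} Q) ∘ f`
(`soloInformed_initForm_rename`), so a polynomial in the first `i` variables that is
cube-nondegenerate in `ℚ[x₁, …, xᵢ]` stays cube-nondegenerate in `ℚ[x₁, …, xₙ]`.

**MZV integrals.**  A convergent multiple zeta value `ζ(s₁, …, s_k)` (`s₁ ≥ 2`) of weight `w` is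
the iterated integral of the word `ω₀^{s₁−1} ω₁ ⋯ ω₀^{s_k−1} ω₁` over the simplex
`1 > t₁ > ⋯ > t_w > 0`; in cubical coordinates `tᵢ = x₁ ⋯ xᵢ` it becomes
`∫_{[0,1]^w} x^α / ∏_{i ∈ E} (1 − x₁ ⋯ xᵢ) dx` with `E` the positions of the letters `ω₁` and
`α ∈ ℕ^w` (e.g. `ζ(2,1) = ∫ x₁x₂ /((1 − x₁x₂)(1 − x₁x₂x₃))`).  After the corner move `x ↦ 1 − x` the
denominator is `∏_{i ∈ E} Fᵢ` with the **MZV factors** `Fᵢ = 1 − ∏_{j ≤ i} (1 − x_j)`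
(`soloInformedMZVFactor`), each the ζ(i)-denominator in the first `i` variables, hence
cube-nondegenerate (`soloInformed_cubeNondegenerate_mzvFactor`), and the numerator is a polynomial.
THEOREM MZV-CUBE (`soloInformed_presentable_mzvCube`): every `[[0,1]ⁿ, P/∏_t F_{d_t}]` with
depths `0 < d_t ≤ n` and `P ∈ ℚ[x]` arbitrary is presentable inside the KZ calculus (`k = 1`) —
the cube crux `SoloInformedAyoubCubeResolutionCube` holds for all corner-moved cubical MZV
integrands.

References: A. G. Kouchnirenko, Invent. Math. 32 (1976) §1; F. Brown, "Multiple zeta values and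
periods of moduli spaces 𝔐_{0,n}", Ann. Sci. ÉNS 42 (2009) §1; J. Ayoub, EMS Newsl. 91 (2014) §2.2.
-/

noncomputable section

open scoped BigOperators
open MeasureTheory Set
open Literature.NumberTheory.Transcendental Literature.NumberTheory.Transcendental.KZ

namespace Summit.KontsevichZagierPeriods.KontsevichZagierPeriods.Theorems

variable {n r : ℕ}

/-! ### Renaming variables -/

/-- The `w`-degree of a transported exponent is the `(w ∘ f)`-degree. [this work] -/
theorem soloInformed_wdeg_mapDomain (f : Fin r → Fin n) (hf : Function.Injective f)
    (w : Fin n → ℕ) (b : Fin r →₀ ℕ) :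
    soloInformedWDeg w (Finsupp.mapDomain f b) = soloInformedWDeg (w ∘ f) b := by
  classical
  unfold soloInformedWDeg
  have h1 : ∑ i, w i * Finsupp.mapDomain f b i =
      ∑ i ∈ Finset.univ.image f, w i * Finsupp.mapDomain f b i :=
    (Finset.sum_subset (Finset.subset_univ _) fun i _ hi => by
      rw [Finsupp.mapDomain_notin_range, mul_zero]
      rintro ⟨j, rfl⟩
      exact hi (Finset.mem_image_of_mem f (Finset.mem_univ j))).symm
  rw [h1, Finset.sum_image fun j _ j' _ h => hf h]
  simp only [Function.comp_apply, Finsupp.mapDomain_apply hf]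

/-- Transport of initiality along an injective renaming. [this work] -/
theorem soloInformed_isInit_rename_iff (f : Fin r → Fin n) (hf : Function.Injective f)
    (w : Fin n → ℕ) (Q : MvPolynomial (Fin r) ℚ) (a : Fin r →₀ ℕ) :
    SoloInformedIsInit w (MvPolynomial.rename f Q) (Finsupp.mapDomain f a) ↔
      SoloInformedIsInit (w ∘ f) Q a := by
  classical
  unfold SoloInformedIsInit
  rw [MvPolynomial.support_rename_of_injective hf]
  constructor
  · intro h b hb
    simpa only [soloInformed_wdeg_mapDomain f hf] using h _ (Finset.mem_image_of_mem _ hb)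
  · intro h b hb
    obtain ⟨a, ha, rfl⟩ := Finset.mem_image.1 hb
    simpa only [soloInformed_wdeg_mapDomain f hf] using h a ha

/-- **Initial forms commute with injective renaming**: `in_w(rename f Q) = rename f (in_{w∘f} Q)`.
[this work] -/
theorem soloInformed_initForm_rename (f : Fin r → Fin n) (hf : Function.Injective f)
    (w : Fin n → ℕ) (Q : MvPolynomial (Fin r) ℚ) :
    soloInformedInitForm w (MvPolynomial.rename f Q) =
      MvPolynomial.rename f (soloInformedInitForm (w ∘ f) Q) := by
  classical
  ext e
  rw [soloInformed_coeff_initForm]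
  by_cases he : ∃ a : Fin r →₀ ℕ, Finsupp.mapDomain f a = e
  · obtain ⟨a, rfl⟩ := he
    rw [MvPolynomial.coeff_rename_mapDomain f hf, MvPolynomial.coeff_rename_mapDomain f hf,
      soloInformed_coeff_initForm, soloInformed_isInit_rename_iff f hf]
  · push Not at he
    rw [MvPolynomial.coeff_rename_eq_zero f _ e fun u hu => absurd hu (he u),
      MvPolynomial.coeff_rename_eq_zero f _ e fun u hu => absurd hu (he u)]
    simp

/-- **Extension lemma**: cube-nondegeneracy is stable under injective renaming of the variables
(e.g. `ℚ[x₁, …, xᵣ] ↪ ℚ[x₁, …, xₙ]`). [this work] -/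
theorem soloInformed_cubeNondegenerate_rename (f : Fin r → Fin n) (hf : Function.Injective f)
    {Q : MvPolynomial (Fin r) ℚ} (hQ : SoloInformedCubeNondegenerate Q) :
    SoloInformedCubeNondegenerate (MvPolynomial.rename f Q) := by
  intro w y hy
  rw [soloInformed_initForm_rename f hf, MvPolynomial.aeval_rename]
  exact hQ (w ∘ f) (y ∘ f) fun i => hy (f i)

/-! ### The MZV factors -/

/-- The corner-moved **MZV factor of depth `i`** in `n ≥ i` variables:
`Fᵢ = 1 − ∏_{j < i} (1 − x_j)` (the ζ(i)-denominator in the first `i` variables; before the corner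
move `x ↦ 1 − x` it is `1 − x₁ ⋯ xᵢ`). [Brown 2009, §1; this work] -/
def soloInformedMZVFactor (n i : ℕ) (h : i ≤ n) : MvPolynomial (Fin n) ℚ :=
  MvPolynomial.rename (Fin.castLE h) (soloInformedZetaDenominator i)

/-- Evaluation of the MZV factor. [this work] -/
theorem soloInformed_aeval_mzvFactor {i : ℕ} (h : i ≤ n) (x : Fin n → ℝ) :
    MvPolynomial.aeval x (soloInformedMZVFactor n i h) =
      1 - ∏ j : Fin i, (1 - x (Fin.castLE h j)) := by
  unfold soloInformedMZVFactor
  rw [MvPolynomial.aeval_rename, soloInformed_aeval_zetaDenominator]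
  rfl

/-- **The MZV factors are cube-nondegenerate** (depth `i ≥ 1`). [this work] -/
theorem soloInformed_cubeNondegenerate_mzvFactor {i : ℕ} (hi : 0 < i) (h : i ≤ n) :
    SoloInformedCubeNondegenerate (soloInformedMZVFactor n i h) :=
  soloInformed_cubeNondegenerate_rename (Fin.castLE h) (Fin.castLE_injective h)
    (soloInformed_cubeNondegenerate_zetaDenominator hi)

/-! ### THEOREM MZV-CUBE -/

/-- **THEOREM MZV-CUBE.**  For depths `0 < d_t ≤ n` (`t < k`, repetitions allowed) and any
`P ∈ ℚ[x₁, …, xₙ]`, every `IntegralRep` on `[0,1]ⁿ` whose integrand on the open cube is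
`P(x) / ∏_t (1 − ∏_{j < d_t} (1 − x_j))` is presentable: `of r − ∑ⱼ cⱼ • of ρⱼ ∈ KZ.relations`
with cube integrals `ρⱼ` of real parts of germs holomorphic near the closed cube (`k = 1`).  In
particular the cube crux holds for every corner-moved cubical MZV integrand. [this work] -/
theorem soloInformed_presentable_mzvCube {k : ℕ} (d : Fin k → ℕ) (hd : ∀ t, 0 < d t ∧ d t ≤ n)
    (P : MvPolynomial (Fin n) ℚ) (r : IntegralRep n) (hr : r.domain = soloInformedCube n)
    (hri : EqOn r.integrand (fun x => MvPolynomial.aeval x P /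
      ∏ t, (1 - ∏ j : Fin (d t), (1 - x (Fin.castLE (hd t).2 j)))) (soloInformedOpenCube n)) :
    of r ∈ soloInformedPresentable :=
  soloInformed_presentable_of_nondegenerate_factors Finset.univ
    (fun t => soloInformedMZVFactor n (d t) (hd t).2)
    (fun t _ => soloInformed_cubeNondegenerate_mzvFactor (hd t).1 (hd t).2) P r hr fun x hx => by
      rw [hri hx]
      simp only [soloInformed_aeval_mzvFactor]

/-- THEOREM MZV-CUBE in the output format of the cube crux `SoloInformedAyoubCubeResolutionCube`.
[this work] -/
theorem soloInformed_cubeResolution_mzvCube {k : ℕ} (d : Fin k → ℕ) (hd : ∀ t, 0 < d t ∧ d t ≤ n)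
    (P : MvPolynomial (Fin n) ℚ) (r : IntegralRep n) (hr : r.domain = soloInformedCube n)
    (hri : EqOn r.integrand (fun x => MvPolynomial.aeval x P /
      ∏ t, (1 - ∏ j : Fin (d t), (1 - x (Fin.castLE (hd t).2 j)))) (soloInformedOpenCube n)) :
    ∃ (k' : ℕ) (_ : k' ≠ 0) (m : ℕ) (d' : Fin m → ℕ) (G : ∀ j, SoloInformedCubeGerm (d' j))
      (c : Fin m → ℤ) (ρ : ∀ j, IntegralRep (d' j)),
      (∀ j, (ρ j).domain = soloInformedCube (d' j)) ∧
      (∀ j, EqOn (ρ j).integrand (fun x => ((G j).g (soloInformedToC (d' j) x)).re)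
        (soloInformedCube (d' j))) ∧
      k' • of r - ∑ j, c j • of (ρ j) ∈ relations :=
  soloInformed_exists_fin_of_presentable (soloInformed_presentable_mzvCube d hd P r hr hri)

/-- Example (`ζ(2,1)`-type denominator in three variables, corner-moved):
`[[0,1]³, P/((1 − (1−x₀)(1−x₁)) · (1 − (1−x₀)(1−x₁)(1−x₂)))]` is presentable. [this work] -/
theorem soloInformed_presentable_zeta21Denominator (P : MvPolynomial (Fin 3) ℚ) (r : IntegralRep 3)
    (hr : r.domain = soloInformedCube 3)
    (hri : EqOn r.integrand (fun x => MvPolynomial.aeval x P /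
      ((1 - (1 - x 0) * (1 - x 1)) * (1 - (1 - x 0) * (1 - x 1) * (1 - x 2))))
      (soloInformedOpenCube 3)) :
    of r ∈ soloInformedPresentable := by
  have h2 : (2 : ℕ) ≤ 3 := by norm_num
  have h3 : (3 : ℕ) ≤ 3 := le_rfl
  refine soloInformed_presentable_of_nondegenerate_rational P
    (soloInformedMZVFactor 3 2 h2 * soloInformedMZVFactor 3 3 h3)
    (soloInformed_cubeNondegenerate_mul
      (soloInformed_cubeNondegenerate_mzvFactor (by norm_num) h2)
      (soloInformed_cubeNondegenerate_mzvFactor (by norm_num) h3)) r hr fun x hx => ?_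
  rw [hri hx]
  simp only [map_mul, soloInformed_aeval_mzvFactor, Fin.prod_univ_two, Fin.prod_univ_three]
  rfl

end Summit.KontsevichZagierPeriods.KontsevichZagierPeriods.Theorems
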